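import Literature.MathematicalPhysics.QuantumFieldTheory.Balaban1983to89.Beta.OneBlockTorusKKT
import Literature.MathematicalPhysics.QuantumFieldTheory.BlochPeriodicCochains

/-!
# One-block torus KKT uniqueness — UNCONDITIONAL: the cohomological input (Hdg) discharged from
# `BlochPeriodicCochains.exists_const_add_td₀`

HONEST FRAMING (binding, verbatim): "discharging BetaPertH makes Balaban's UV stability UNCONDITIONAL — a real
constructive-QFT result; it is NOT the continuum limit and NOT the Clay problem."  This module is NOT summit progress.

WHAT THIS FILE IS.  [folklore] a twenty-line bridge.  `Beta.OneBlockTorusKKT.oneBlock_uniqueness` (sibling) proves, on the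
one-block discrete torus `𝕋 = Fin d → ZMod N` with explicit `d0`, `d1`, `const`, `Q` and codifferentials `LinearMap.adjoint _`,
that the homogeneous KKT system (`δ1 d1 D = Qᵀ φ + d0 ψ`, `Q D = 0`, `δ0 D = 0`) forces `D = 0` — under ONE hypothesis
`Hdg d N` («a 1-cochain with vanishing plaquette sums is a constant cochain plus a gradient»).  That hypothesis is the
torus form of `H¹((ℤ/Nℤ)^d)` = constants, PROVED (append-only v1.1 of the lit2 lineage's module) as
`LatticeForm.exists_const_add_td₀` for cochains `θ : TorusSite d N → Fin d → V` over any field with `N ≠ 0`.  Here: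
* `hdg_holds : Hdg d N` — the packaging `D (i, y) ↔ θ y i` between `EuclideanSpace ℝ (Fin d × 𝕋)` and curried functions
  (the plaquette formula of `exists_const_add_td₀` is literally `d1_apply`; `Pi.single i 1` is literally `e i`);
* `oneBlock_uniqueness'`, `oneBlock_kkt_trivial'` — the sibling's theorems with the hypothesis removed.
So the one-block (k ≡ 0 fibre) uniqueness statement (TU)_N of HOME/BETA/AN2.md §11 (Y12)(b) (B4) is KERNEL with NO
hypothesis left.  Nothing of Bałaban's manuscripts is asserted (context locators as in the sibling: [Balaban1985Variational]
p. 285 (45), [Balaban1985BackgroundPropagators] p. 394 (3.21), [Balaban1984PropagatorsI] p. 19 (1.11)).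
-/

namespace Literature.MathematicalPhysics.QuantumFieldTheory.Balaban1983to89.Beta.OneBlockTorusKKT

open scoped InnerProductSpace
open Literature.MathematicalPhysics.QuantumFieldTheory.LatticeForm (td₀ exists_const_add_td₀)

variable {d N : ℕ} [NeZero N]

/-- **(Hdg) HOLDS** on the one-block torus: a 1-cochain with `d1 D = 0` is `const c + d0 l`
(from `LatticeForm.exists_const_add_td₀`, H¹ of `(ℤ/Nℤ)^d` represented by constants). [folklore] -/
theorem hdg_holds (d N : ℕ) [NeZero N] : Hdg d N := by
  intro D hD
  have hN : ((N : ℕ) : ℝ) ≠ 0 := Nat.cast_ne_zero.2 (NeZero.ne N)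
  have hcl : ∀ (y : 𝕋 d N) (i j : Fin d),
      D (i, y) + D (j, y + Pi.single i 1) - D (i, y + Pi.single j 1) - D (j, y) = 0 := by
    intro y i j
    have h := congrArg (fun F : C2 d N => F ((i, j), y)) hD
    simpa [d1_apply, e] using h
  obtain ⟨c, μ, hθ, -⟩ :=
    exists_const_add_td₀ (𝕜 := ℝ) (V := ℝ) (d := d) (N := N) hN (fun y i => D (i, y)) hcl
  refine ⟨mk c, mk μ, ?_⟩
  ext ⟨i, y⟩
  have h := congrFun (congrFun hθ y) i
  simp only [Pi.add_apply, td₀] at h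
  simp only [PiLp.add_apply, const_apply, d0_apply, mk_apply, e]
  exact h

/-- **ONE-BLOCK TORUS UNIQUENESS, UNCONDITIONAL**: stationarity with multipliers, zero block sum and the codifferential
gauge force `D = 0`. [folklore] -/
theorem oneBlock_uniqueness' {D : C1 d N} {φ : W d} {ψ : C0 d N}
    (hstat : LinearMap.adjoint d1 (d1 D) = LinearMap.adjoint Q φ + d0 ψ)
    (hQ : Q D = 0) (hg : LinearMap.adjoint d0 D = 0) : D = 0 :=
  oneBlock_uniqueness (hdg_holds d N) hstat hQ hg

/-- … with trivial multipliers: the one-block (k = 0) KKT matrix is injective, unconditionally. [folklore] -/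
theorem oneBlock_kkt_trivial' {D : C1 d N} {φ : W d} {ψ : C0 d N}
    (hstat : LinearMap.adjoint d1 (d1 D) = LinearMap.adjoint Q φ + d0 ψ)
    (hQ : Q D = 0) (hg : LinearMap.adjoint d0 D = 0) : D = 0 ∧ φ = 0 ∧ d0 ψ = 0 :=
  oneBlock_kkt_trivial (hdg_holds d N) hstat hQ hg

/-- INJECTIVITY FORM: the linear map `(D, φ, ψ) ↦ (δ1 d1 D − Qᵀ φ − d0 ψ, Q D, δ0 D)` has kernel `{(0, 0, ψ) : d0 ψ = 0}` —
stated as: two solutions of the INHOMOGENEOUS one-block system with the same data have the same `D` and `φ`. [folklore] -/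
theorem oneBlock_solution_unique {D D' : C1 d N} {φ φ' : W d} {ψ ψ' : C0 d N} {J : C1 d N} {b : W d} {g : C0 d N}
    (h : LinearMap.adjoint d1 (d1 D) = LinearMap.adjoint Q φ + d0 ψ + J) (hQ : Q D = b)
    (hg : LinearMap.adjoint d0 D = g)
    (h' : LinearMap.adjoint d1 (d1 D') = LinearMap.adjoint Q φ' + d0 ψ' + J) (hQ' : Q D' = b)
    (hg' : LinearMap.adjoint d0 D' = g) : D = D' ∧ φ = φ' := by
  have hstat : LinearMap.adjoint d1 (d1 (D - D')) = LinearMap.adjoint Q (φ - φ') + d0 (ψ - ψ') := by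
    rw [map_sub, map_sub, h, h', map_sub, map_sub]; abel
  have hQ0 : Q (D - D') = 0 := by rw [map_sub, hQ, hQ', sub_self]
  have hg0 : LinearMap.adjoint d0 (D - D') = 0 := by rw [map_sub, hg, hg', sub_self]
  obtain ⟨hD, hφ, -⟩ := oneBlock_kkt_trivial' hstat hQ0 hg0
  exact ⟨sub_eq_zero.1 hD, sub_eq_zero.1 hφ⟩

end Literature.MathematicalPhysics.QuantumFieldTheory.Balaban1983to89.Beta.OneBlockTorusKKT
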